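import Literature.IUT.HodgeArakelov.LocalKummerDataBridge
import Literature.IUT.HodgeTheaters.LocalFrobenioidsArch

/-!
# [IUTchII] Def 4.9 (v)/(vi)(c): the archimedean datum `‡F^{⊢▶×μ}_w` from [IUTchI] Example 3.4 (bridge)

Merge bridge (abc-iut cell, layer L6 → L5; no re-typing). The archimedean local datum of an
`F^{⊢▶×μ}`-prime-strip (`ArchTriMuDatum` of `KummerPrimeStrips.lean`, [IUTchII] Def 4.9 (v) p. 157)
determined by an `ArchLocalFrobenioid` (`Literature.IUT.HodgeTheaters.ArchLocalFrobenioid`, [IUTchI] Ex 3.4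
pp. 80–82): the monoid `O^▷(C_v)` (`X.OC`), the image of the characteristic splitting `τ^⊢_v` (`X.tauDash`),
and the "sort of Kummer structure" of Def 4.9 (v) on the compact factor `O^×_{C^⊢_v}` taken tautologically
(`ArchimedeanKummerData.tautological`; the identification `(‡D^⊢_w)^× ≅ O^×_{C^⊢_v}` of Ex 3.4 (ii) —
"isomorphic — but not canonically!" — being the chosen one). Claim key `Mochizuki2012` DISPUTED (D-0012):
definitions only; nothing here asserts a disputed claim.
-/

namespace Literature.IUT.HodgeArakelov

open Literature.IUT.HodgeTheaters

universe u

/-! ### 2. The archimedean local datum of Def 4.9 (v)/(vi)(c) from [IUTchI] Example 3.4 -/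

/-- **[IUTchII] Def 4.9 (v) p. 157 over [IUTchI] Ex 3.4**: the archimedean datum `‡F^{⊢▶×μ}_w` determined by an
`ArchLocalFrobenioid` — the monoid `O^▷(C_v)` of `‡F^⊢_w` (Ex 3.4 (i) `X.OC`, "reconstructed
category-theoretically from `C`"), the image of its characteristic splitting `τ^⊢_v` (Ex 3.4 (ii) `X.tauDash`,
the preimage of `(0,1] ⊆ 𝒪^▷_{K_v}`), and the Kummer structure of (v) on the compact factor `O^×_{C^⊢_v}`
(`X.unitsDash`), taken tautologically (the identification `(‡D^⊢_w)^× ≅ O^×_{C^⊢_v}` of Ex 3.4 (ii) being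
chosen). [cite: Mochizuki2012, Def 4.9 (v) p.157] -/
def ArchTriMuDatum.ofArch {Kv : Type u} [NormedField Kv] [NormedAlgebra ℝ Kv]
    (X : ArchLocalFrobenioid.{u} Kv) : ArchTriMuDatum.{u} where
  O := CommMonCat.of X.OC
  splitting := X.tauDash
  kummer := ArchimedeanKummerData.tautological X.OC

/-- The underlying monoid of `ArchTriMuDatum.ofArch X` is `O^▷(C_v)`. [cite: Mochizuki2012, Def 4.9 (v) p.157] -/
theorem ArchTriMuDatum.ofArch_O {Kv : Type u} [NormedField Kv] [NormedAlgebra ℝ Kv]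
    (X : ArchLocalFrobenioid.{u} Kv) : ((ArchTriMuDatum.ofArch X).O : Type u) = X.OC := rfl

/-- Its splitting is the characteristic splitting `τ^⊢_v` of [IUTchI] Ex 3.4 (ii). [cite: Mochizuki2012, Def 4.9 (v) p.157] -/
theorem ArchTriMuDatum.ofArch_splitting {Kv : Type u} [NormedField Kv] [NormedAlgebra ℝ Kv]
    (X : ArchLocalFrobenioid.{u} Kv) : (ArchTriMuDatum.ofArch X).splitting = X.tauDash := rfl

/-- **[IUTchII] Def 4.9 (vi) (c) p. 157**: at `v ∈ V^arc` the local datum of an `F^{⊢▶×μ}`-prime-strip is the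
archimedean datum — here the one determined by an `ArchLocalFrobenioid` ([IUTchI] Ex 3.4).
[cite: Mochizuki2012, Def 4.9 (vi) p.157] -/
def LocalTriMuDatum.ofArch (l : ℕ) (G : Type u) [Group G] (XG : GroupTheoreticUnits.{u, u} G)
    {Kv : Type u} [NormedField Kv] [NormedAlgebra ℝ Kv] (X : ArchLocalFrobenioid.{u} Kv) :
    LocalTriMuDatum.{u, u, u} l G XG PlaceKind.arch :=
  LocalTriMuDatum.arch (ArchTriMuDatum.ofArch X)

/-- The monoid underlying the archimedean local datum is `O^▷(C_v)`. [cite: Mochizuki2012, Def 4.9 (vi) p.157] -/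
theorem LocalTriMuDatum.ofArch_O (l : ℕ) (G : Type u) [Group G] (XG : GroupTheoreticUnits.{u, u} G)
    {Kv : Type u} [NormedField Kv] [NormedAlgebra ℝ Kv] (X : ArchLocalFrobenioid.{u} Kv) :
    ((LocalTriMuDatum.ofArch l G XG X).O : Type u) = X.OC := rfl


end Literature.IUT.HodgeArakelov
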